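import Literature.MathematicalPhysics.QuantumFieldTheory.Balaban1983to89.B9Thm37GpTorusRegular
import Literature.MathematicalPhysics.QuantumFieldTheory.Balaban1983to89.B9Thm37Glue

/-!
# `Balaban1983to89.B9Thm37GpTorusRegularEntries` — T. Bałaban, *Propagators for lattice gauge theories in a background field*, Commun. Math.
# Phys. **99** (1985) 389–434 [Balaban1985BackgroundPropagators], Theorem 3.7 (3.87)–(3.90) pp. 409–410 ⇒ the second, third and fourth
# inequalities (3.42) of Theorem 3.1 for `G′(U)` AT def-Y's CARRIERS, and the four entries assembled into the (3.42) block of the reading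
# `kernelFamilySInv` over the gauge-invariant test class (FILE 2 of M5.5: hypotheses displayed, exactly as FILE 1 `B9Thm37GpTorusRegular`)

statement-level skeleton of published theorems with citation tags; proofs where landed; nothing here is a claim about the Yang–Mills mass gap

PDF held: `paper:balaban1985-cmp99-background-propagators` (journal page = PDF page + 388); pp. 397, 403, 409–410 read from the held text layer;
[4] = [Balaban1984PropagatorsII], Prop. 2.2 (2.64)–(2.67) p. 234.

THE PRINT.  p. 397 (3.42): *«|(G′(U)λ)(x)|, |(∇_U G′(U)λ)(x)|, |(G′(U)∇*_U λ)(x)|, |(Δ_U G′(U)λ)(x)| ≦ B₀[(Lʲη)², Lʲη, Lʲη, 1]e^{−δ₀d(y,y′)}|λ| for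
x ∈ Δ(y), y ∈ Λ_j, supp λ ⊂ Δ(y′)»*.  p. 409, Theorem 3.7: *«For M sufficiently large, and a configuration U satisfying (3.35), the operator G′
can be represented as G′ = G′₀(I − R′)⁻¹ = G′₀Σ_{n=0}^∞R′ⁿ = … (3.90) … The expansion is convergent in all norms appearing in the inequalities
(3.42)–(3.47).»*  p. 410: *«This theorem follows simply from Corollary 3.6 holding for all G′_□, □ ∈ 𝒟, from the bound (3.89) and Lemma 2.1.
The arguments are exactly the same as in proofs of Proposition 1.2 [3] and Proposition 2.2 [4] … Theorem 3.7 implies that all the inequalities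
(3.42)–(3.47) hold for G′»*; [4] p. 234 (proof of Prop. 2.2, after (2.66)): *«The similar inequalities hold for a derivative of G′λ and for a
Hölder norm of a derivative, but with (Lʲη)² replaced by Lʲη and (Lʲη)^{1−α} correspondingly … (2.67) … The random walk representation (2.50) is
convergent in the norms defined by these inequalities.»*; p. 403: *«of course with different constants»*.

WHY THIS FILE (cell context: G-B9-LETTERS, module M5.5 FILE 2; FILE 1 = `B9Thm37GpTorusRegular` did the first entry).  def-Y's difference letters
are site → site operators PER DIRECTION `μ` (`B9Eq352GradLetters.diffLetter (shiftY i) Uc η⁻¹ (inl μ ∕ inr μ)`, the `η⁻¹∇_{U,μ}` resp. `−η⁻¹∇*_{U,μ}` of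
(3.3)∕(3.8)), so after realification by `B9Eq352DivFormLetters.conj b` ALL four entries of (3.42) are block majorants of operators on ONE real
function lattice `SiteY i × ι` ([4] (2.51)), and the p. 410 argument runs in the one-lattice calculus of `B6RandomWalk`:
* LEFT entries (`∇_UG′`, `Δ_UG′`; §2): the fixed point `G′ = G′₀ + G′R′` of (3.88)∕(3.90) (`B9Thm37Sum.fixedPoint_of_388`, from `hinv`, `h388` as in
  FILE 1) multiplied by ANY real-coordinate left factor `E` is again a right fixed point `EG′ = EG′₀ + (EG′)R′` (`conj_leftFix`); `EG′₀ = Σ_□ E(h_□G′_□h_□)`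
  is a finite sum of cube terms whose majorants (displayed: `hTE`, summed bound `hKE` with weight `W`) add up, `R′` is FILE 1's `h389`, and
  `B6RandomWalk.majorant_of_fixedPoint_266` ([4] (2.64)–(2.66) via Lemma 2.1) gives `EG′` the majorant `A_E c₁(α)(1 − N′θc₁(α))⁻¹W(y)e^{−(1−α)δ₀d}` —
  the E-entry of (3.42) for `G′(U)` «with (Lʲη)² replaced by» `W` (★★ `hasMajorant_left_conj_Gp_of_cubes`);
* the RIGHT entry (`G′∇*_U`; §3) needs the expansion read from the left: `Δ′_aG′ = 1` (from `hinv`, the real-coordinate lattice being finite: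
  `mul_eq_one_comm`) and the transposed form of (3.88), `G′₀Δ′_a = 1 − V` with `V = Σ_□ V_□` (displayed: `h388T`; the cell's reading of record for
  entry 3, r06's `B9Thm37Glue` v4 `fixedPoint_of_388T` — in print `V_□ = h_□G′_□K(h_□)ᵗ`), give the LEFT fixed point `G′F = G′₀F + V(G′F)` for any
  right factor `F` (`conj_rightFix`); with the cube terms `h_□G′_□h_□F` (displayed: `hTF`, `hKF`, weight `Lʲη`) and the SCALE-WEIGHTED majorant
  `θ·ℓ(y)ℓ(y′)⁻¹e^{−δ₀d}` of `V` (displayed: `hV`, `hKV` — the shape of r06's `rightR_cube_majorant`), `B6RandomWalkHom.hom_majorant_of_leftFixedPoint_weighted`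
  ((2.65)–(2.66) read from the left, two uses of Lemma 2.1) gives `G′F` the majorant `A_F c₁(α)(1 − θc₁(α))⁻¹ℓ(y)e^{−(1−2α)δ₀d}`
  (★★ `hasMajorant_right_conj_Gp_of_cubes`);
* §4 assembles FILE 1's entry (`B9Thm37GpTorusRegular.hasMajorant_conj_Gp_of_cubes`), the `d + 1` forward entries, the `d + 1` backward entries
  and the Laplacian entry at `G := η²·G′(U)`, `η = etaS i`, common rate `(1 − 2α)δ₀` and the SUM of the four constants, and WRITES them back over the
  invariant class by `B9CubeLettersInvWriteDict.eBlock_kernelFamilySInv_of_hasMajorant`: ★★ `eBlock_kernelFamilySInv_Gp_of_cubes` —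
  `EBlock (kernelFamilySInv i B cfg G′ par) (M₂(Σ_j‖b_j‖)·Bc) ((1−2α)δ₀) U₁`, ALL FOUR INEQUALITIES (3.42) FOR `G′(U)` AT A GENERAL REGULAR `U`,
  modulo the displayed cube inputs (the `gp_sup ∕ gp_grad ∕ gp_div ∕ gp_lap` lines of the consumer M5.9).
DISPLAYED HYPOTHESES (named outputs of sibling modules, as in FILE 1; discharged at the cube cover of record by the sequel `…EntriesCubes`, the twin
of FILE 3 `B9Thm37GpTorusRegularCubes`): `hT`∕`hcnt` and `h389`∕`hcnt'` (FILE 1's, verbatim); per direction `μ` the localized majorants `hTE μ` of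
`conj b(η⁻¹∇_μ)·conj b(η²T_□)` and `hTF μ` of `conj b(η²T_□)·conj b(−η⁻¹∇*_μ)`, and `hTL` of `conj b(η⁻²Δ_U)·conj b(η²T_□)` — Cor. 3.6 entries 2–4 for
`G′_□` through the cut-offs' Leibniz rules (p38's `B9Eq3104CutoffCommutators(Sizes)`, (3.100)–(3.104) pp. 413–414) — with their summed bounds; `hV`∕`hKV`
and `h388T`; `hinv`, `h388`; [4] Lemma 2.1 at exponent `α` (`h261`, `h263` at `toB6 (geo9K i) Rr Hp`, FILE 1 §5 above one M-threshold); the located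
smallness `N′θc₁(α) < 1`, `θ_V c₁(α) < 1` («for M sufficiently large»).  Nothing of Theorem 3.7's summation, of [4] Lemma 2.1 or of the dictionary
is re-proved; no sizes are asserted.

WHAT IS PROVED (all `theorem`s, no `sorry`).  §1 `conj_leftFix`, `conj_scaled_388T`, `conj_rightFix`; §2 ★★ `hasMajorant_left_conj_Gp_of_cubes`;
§3 ★★ `hasMajorant_right_conj_Gp_of_cubes`; §4 `kernel_mono`, ★★ `eBlock_kernelFamilySInv_Gp_of_cubes`.
-/

noncomputable section

namespace Literature.MathematicalPhysics.QuantumFieldTheory.Balaban1983to89.B9Thm37GpTorusRegularEntries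

open Node00 B9CubeLettersInvReadings B9CubeLettersInvReadDict B9CubeLettersInvWriteDict B9Thm37GpTorusRegular
open B6Geom246MultiLevelBox (blkOf)
open B6Ineq2142KLevelV1 (β)
open B6KLevelCensusIndexV1 (KIdx)
open B6RandomWalk (HasMajorant Triangle254 Ineq261 Ineq263 hasMajorant_mono majorant_of_fixedPoint_266 c1_nonneg)
open B6RandomWalkHom (HasMajorantHom hasMajorantHom_iff hom_majorant_of_leftFixedPoint_weighted)
open B9Thm34Ext (toB6 toB6_dist)
open B9GeoNormsKLevelV1 (geo9K)
open B9Eq352DivFormLetters (conj conj_sub)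
open B9Eq352GradLetters (diffLetter)
open B9Ineq349SiteComposite (etaS_pos)
open B9Thm37Sum (fixedPoint_of_388 hasMajorant_finsetSum hasMajorant_localSum)
open B9Thm37Glue (fixedPoint_of_388T)
open B9FromB6 (EBlock)
open scoped Matrix

variable {d ℓ : ℕ} {hd : 1 ≤ d + 1} {hL : Odd (ℓ + 1) ∧ 1 < ℓ + 1} {b₀ b₁ : ℝ}
variable {𝔸 : Type} [NormedRing 𝔸] [NormedAlgebra ℂ 𝔸] [CompleteSpace 𝔸]
variable {ι : Type} [Fintype ι]
variable (i : KIdx d ℓ hd hL b₀ b₁) (b : Module.Basis ι ℝ 𝔸)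

/-! ## §1 The two fixed points of the expansion (3.90) in real coordinates, for a left and for a right factor -/

section Algebra

variable {S : Type}

omit [CompleteSpace 𝔸] in
/-- **`EG′ = EG′₀ + (EG′)R′` FOR ANY LEFT FACTOR `E`** (the fixed point `G′ = G′₀ + G′R′` of (3.88)∕(3.90), `B9Thm37Sum.fixedPoint_of_388` on the
real-coordinate letters of FILE 1 §1, multiplied on the left): with the scale weights, `E·conj b(η²G′) = Σ_□ E·conj b(η²T_□) + (E·conj b(η²G′))·Σ_□ conj b R_□`.
[cite: Balaban1985BackgroundPropagators, (3.88)–(3.90) p.409; Balaban1984PropagatorsII, (2.50) p.232] -/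
theorem conj_leftFix (Eb : Module.End ℝ (S × ι → ℝ)) {η : ℝ} (hη : η ≠ 0) {κ : Type} [Fintype κ]
    {G Δ : Module.End ℝ (S → 𝔸)} {T R : κ → Module.End ℝ (S → 𝔸)}
    (hinv : G * Δ = 1) (h388 : Δ * (∑ k, T k) = 1 - ∑ k, R k) :
    Eb * conj b ((η ^ 2) • G) = (∑ k, Eb * conj b ((η ^ 2) • T k)) + Eb * conj b ((η ^ 2) • G) * ∑ k, conj b (R k) := by
  have hfix := fixedPoint_of_388 (conj_scaled_mul_inv b hη hinv) (conj_scaled_388 b hη h388)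
  conv_lhs => rw [hfix]
  rw [mul_add, Finset.mul_sum, ← mul_assoc]

omit [CompleteSpace 𝔸] in
/-- **THE TRANSPOSED (3.88) IN REAL COORDINATES, with the scale weights**: `(Σ_□ conj b(η²T_□))·conj b(η⁻²Δ′_a) = 1 − Σ_□ conj b V_□` from
`(Σ_□ T_□)·Δ′_a = 1 − Σ_□ V_□` (the form `G′₀Δ′_a = I − V` of the cell's reading of record for the right entry, r06's `B9Thm37Glue` v4: for the
symmetric `Δ′_a, G′_□, h_□` of print it is (3.88) transposed, `V_□ = h_□G′_□K(h_□)ᵗ`). [cite: Balaban1985BackgroundPropagators, (3.88) p.409 (transposed), (3.42)₃ p.397] -/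
theorem conj_scaled_388T {η : ℝ} (hη : η ≠ 0) {κ : Type} [Fintype κ] {Δ : Module.End ℝ (S → 𝔸)} {T V : κ → Module.End ℝ (S → 𝔸)}
    (h388T : (∑ k, T k) * Δ = 1 - ∑ k, V k) :
    (∑ k, conj b ((η ^ 2) • T k)) * conj b ((η ^ 2)⁻¹ • Δ) = 1 - ∑ k, conj b (V k) := by
  have hs : (∑ k, conj b ((η ^ 2) • T k)) = conj b ((η ^ 2) • ∑ k, T k) := by
    rw [Finset.smul_sum, conj_sum]
  rw [hs, ← B9Eq352DivFormLetters.conj_mul, smul_mul_smul_comm, mul_inv_cancel₀ (pow_ne_zero 2 hη), one_smul, h388T, conj_sub, conj_one,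
    conj_sum]

omit [CompleteSpace 𝔸] in
/-- **`G′F = G′₀F + V(G′F)` FOR ANY RIGHT FACTOR `F`**: `G′Δ′_a = 1` gives `Δ′_aG′ = 1` (the real-coordinate lattice `S × ι` is finite:
`mul_eq_one_comm`), and with `G′₀Δ′_a = 1 − V` the LEFT fixed point `G′ = G′₀ + VG′` (`B9Thm37Glue.fixedPoint_of_388T`), multiplied on the right by `F`.
[cite: Balaban1985BackgroundPropagators, (3.88)–(3.90) p.409 (read from the left), (3.24)–(3.25) p.394 (G′ = (Δ′_a)⁻¹)] -/
theorem conj_rightFix [Fintype S] (Fb : Module.End ℝ (S × ι → ℝ)) {η : ℝ} (hη : η ≠ 0) {κ : Type} [Fintype κ]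
    {G Δ : Module.End ℝ (S → 𝔸)} {T V : κ → Module.End ℝ (S → 𝔸)}
    (hinv : G * Δ = 1) (h388T : (∑ k, T k) * Δ = 1 - ∑ k, V k) :
    conj b ((η ^ 2) • G) * Fb = (∑ k, conj b ((η ^ 2) • T k) * Fb) + (∑ k, conj b (V k)) * (conj b ((η ^ 2) • G) * Fb) := by
  have hinv' : conj b ((η ^ 2)⁻¹ • Δ) * conj b ((η ^ 2) • G) = 1 := mul_eq_one_comm.mp (conj_scaled_mul_inv b hη hinv)
  have hfix := fixedPoint_of_388T hinv' (conj_scaled_388T b hη h388T)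
  conv_lhs => rw [hfix]
  rw [add_mul, Finset.sum_mul, mul_assoc]

end Algebra

/-! ## §2 Theorem 3.7 ⇒ a LEFT entry of (3.42) for `G′(U)` at def-Y's carriers (`∇_UG′`: weight `Lʲη`; `Δ_UG′`: weight `1`) -/

section Cubes

variable [DecidableEq ι] [Fintype (geo9K i).Site] [DecidableEq (geo9K i).Site] {Rr : ℝ} {Hp : Prop}
variable (ιB : BlkY i → IBondY i)

omit [CompleteSpace 𝔸] in
/-- ★★ **THEOREM 3.7 ⇒ THE `E`-ENTRY OF (3.42) FOR `G′(U)`, FOR ANY REAL-COORDINATE LEFT FACTOR `E`** ([4] p. 234 «The similar inequalities hold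
for a derivative of G′λ … but with (Lʲη)² replaced by Lʲη»; B9 p. 409 «The expansion is convergent in all norms appearing in the inequalities
(3.42)–(3.47)»): for `𝔸`-letters `G′(U), Δ′_a(U)` with `G′Δ′_a = 1` (`hinv`), cube terms `T_□`, `R_□` with `Δ′_a·Σ_□T_□ = 1 − Σ_□R_□` ((3.88), `h388`),
block majorants `K_{E,□}` of the terms `E·conj b(η²T_□)` of `EG′₀` whose sum is `≤ A·W(a)e^{−δ₀d(a,a′)}` (`hTE`, `hKE` — Cor. 3.6 entry `E` for `G′_□`
through the Leibniz rule of `E` and the cut-off `h_□`), the localized (3.89) majorants of `conj b R_□` with overlap `≤ N′` (`h389`, `hcnt'`, FILE 1's),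
[4] Lemma 2.1 at exponent `α` and `N′θc₁(α) < 1`: `E·conj b(η²G′(U))` has the majorant `A·c₁(α)(1 − N′θc₁(α))⁻¹·W(a)·e^{−(1−α)δ₀d(a,a′)}` —
`B6RandomWalk.majorant_of_fixedPoint_266` on the fixed point `EG′ = EG′₀ + (EG′)R′` (`conj_leftFix`).
[cite: Balaban1985BackgroundPropagators, Thm 3.7 (3.87)–(3.90) pp.409–410, Thm 3.1 (3.42)₂,₄ p.397; Balaban1984PropagatorsII, Prop 2.2 (2.64)–(2.67) p.234] -/
theorem hasMajorant_left_conj_Gp_of_cubes (d' : ℕ) {δ₀ α θ A N' : ℝ} {κ : Type} [Fintype κ]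
    (S' : κ → Finset (geo9K i).Site) {G Δ : Module.End ℝ (SiteY i → 𝔸)} (T R : κ → Module.End ℝ (SiteY i → 𝔸))
    (Eb : Module.End ℝ (SiteY i × ι → ℝ)) (W : (geo9K i).Site → ℝ) (KE : κ → (geo9K i).Site → (geo9K i).Site → ℝ)
    {η : ℝ} (hη : η ≠ 0) (hA : 0 ≤ A) (hW : ∀ a, 0 ≤ W a) (hθ : 0 ≤ θ) (hN' : 0 ≤ N') (hαδ : 0 ≤ (1 - α) * δ₀)
    (htri : Triangle254 (toB6 (geo9K i) Rr Hp)) (hrefl : ∀ y : (geo9K i).Site, (geo9K i).dist y y = 0)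
    (hdnn : ∀ y y' : (geo9K i).Site, 0 ≤ (geo9K i).dist y y')
    (h261 : Ineq261 d' (toB6 (geo9K i) Rr Hp) δ₀ α) (h263 : Ineq263 d' (toB6 (geo9K i) Rr Hp) δ₀ α)
    (hsmall : N' * θ * B6.c1 d' δ₀ α < 1)
    (hTE : ∀ k, HasMajorant (g := toB6 (geo9K i) Rr Hp) (fun p : SiteY i × ι => ιB (blkOf i.D.toDomains p.1))
      (Eb * conj b ((η ^ 2) • T k)) (KE k))
    (hKE : ∀ a a', (∑ k, KE k a a') ≤ A * W a * Real.exp (-(δ₀ * (geo9K i).dist a a')))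
    (h389 : ∀ k, HasMajorant (g := toB6 (geo9K i) Rr Hp) (fun p : SiteY i × ι => ιB (blkOf i.D.toDomains p.1)) (conj b (R k))
      (fun a a' => if a ∈ S' k then θ * Real.exp (-(δ₀ * (geo9K i).dist a a')) else 0))
    (hcnt' : ∀ a : (geo9K i).Site, (∑ k, if a ∈ S' k then (1 : ℝ) else 0) ≤ N')
    (hinv : G * Δ = 1) (h388 : Δ * (∑ k, T k) = 1 - ∑ k, R k) :
    HasMajorant (g := toB6 (geo9K i) Rr Hp) (fun p : SiteY i × ι => ιB (blkOf i.D.toDomains p.1)) (Eb * conj b ((η ^ 2) • G))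
      (fun a a' => A * B6.c1 d' δ₀ α * (1 - N' * θ * B6.c1 d' δ₀ α)⁻¹ * W a *
        Real.exp (-((1 - α) * δ₀ * (geo9K i).dist a a'))) := by
  -- (3.87) with the left factor applied: EG′₀ = Σ_□ E(h_□G′_□h_□), a finite sum of cube terms; the majorants add up ([4] p. 232)
  have hG0 : HasMajorant (g := toB6 (geo9K i) Rr Hp) (fun p : SiteY i × ι => ιB (blkOf i.D.toDomains p.1))
      (∑ k, Eb * conj b ((η ^ 2) • T k)) (fun a a' => A * W a * Real.exp (-(δ₀ * (geo9K i).dist a a'))) :=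
    hasMajorant_mono (g := toB6 (geo9K i) Rr Hp) _
      (hasMajorant_finsetSum (G := toB6 (geo9K i) Rr Hp) _ Finset.univ (fun k => Eb * conj b ((η ^ 2) • T k)) KE fun k _ => hTE k) hKE
  -- R′ = Σ_□ K(h_□)G′_□h_□ has majorant N′θe^{−δ₀d} ((3.89) summed with the overlap count, exactly as in `B9Thm37Sum.thm37_entry1`)
  have h389' : ∀ k, HasMajorant (g := toB6 (geo9K i) Rr Hp) (fun p : SiteY i × ι => ιB (blkOf i.D.toDomains p.1)) (conj b (R k))
      (fun a a' => (if a ∈ S' k then (1 : ℝ) else 0) * (θ * Real.exp (-(δ₀ * (geo9K i).dist a a')))) :=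
    fun k => hasMajorant_mono (g := toB6 (geo9K i) Rr Hp) _ (h389 k) fun a a' => le_of_eq (by split_ifs <;> simp)
  have hR : HasMajorant (g := toB6 (geo9K i) Rr Hp) (fun p : SiteY i × ι => ιB (blkOf i.D.toDomains p.1)) (∑ k, conj b (R k))
      (fun a a' => N' * θ * Real.exp (-(δ₀ * (geo9K i).dist a a'))) := by
    have h := hasMajorant_localSum (G := toB6 (geo9K i) Rr Hp) (fun p : SiteY i × ι => ιB (blkOf i.D.toDomains p.1))
      (fun k => conj b (R k)) (fun k (a : (geo9K i).Site) => if a ∈ S' k then 1 else 0)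
      (fun a a' => θ * Real.exp (-(δ₀ * (geo9K i).dist a a'))) N' (fun a a' => mul_nonneg hθ (Real.exp_nonneg _)) h389' hcnt'
    exact hasMajorant_mono (g := toB6 (geo9K i) Rr Hp) _ h fun a a' => le_of_eq (by ring)
  -- EG′ = EG′₀ + (EG′)R′ and the Neumann series (2.66) via Lemma 2.1
  have h := majorant_of_fixedPoint_266 (g := toB6 (geo9K i) Rr Hp) (fun p : SiteY i × ι => ιB (blkOf i.D.toDomains p.1)) d' δ₀ α
    (N' * θ) A W hA hW (mul_nonneg hN' hθ) hαδ htri hrefl hdnn h261 h263 hsmall hG0 hR (conj_leftFix b Eb hη hinv h388)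
  refine hasMajorant_mono (g := toB6 (geo9K i) Rr Hp) _ h fun a a' => le_of_eq ?_
  simp only [toB6_dist]

/-! ## §3 Theorem 3.7 ⇒ the RIGHT entry of (3.42) for `G′(U)` at def-Y's carriers (`G′∇*_U`, weight `Lʲη`), read from the left -/

omit [CompleteSpace 𝔸] [DecidableEq (geo9K i).Site] in
/-- ★★ **THEOREM 3.7 ⇒ THE RIGHT ENTRY (3.42)₃ FOR `G′(U)`, FOR ANY REAL-COORDINATE RIGHT FACTOR `F`** (B9 p. 410 «Theorem 3.7 implies that all
the inequalities (3.42)–(3.47) hold for G′»; the cell's reading of record for the right entry, r06's `B9Thm37Glue` v4: the expansion read from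
the left): for `𝔸`-letters with `G′Δ′_a = 1` (`hinv`) and the transposed (3.88) `(Σ_□T_□)·Δ′_a = 1 − Σ_□V_□` (`h388T`), block majorants `K_{F,□}` of
the terms `conj b(η²T_□)·F` of `G′₀F` whose sum is `≤ A·ℓ(a)e^{−δ₀d(a,a′)}` (`hTF`, `hKF` — Cor. 3.6 entry 3 for `G′_□` through the right Leibniz rule of
`h_□`), block majorants `K_{V,□}` of `conj b V_□` whose sum is scale-weighted, `≤ θ·ℓ(a)ℓ(a′)⁻¹e^{−δ₀d(a,a′)}` (`hV`, `hKV`), [4] Lemma 2.1 at exponent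
`α` (with `0 ≤ αδ₀`, `0 ≤ (1−2α)δ₀`, `d` symmetric, `ℓ > 0`) and `θc₁(α) < 1`: `conj b(η²G′(U))·F` has the majorant
`A·c₁(α)(1 − θc₁(α))⁻¹·ℓ(a)·e^{−(1−2α)δ₀d(a,a′)}` — `B6RandomWalkHom.hom_majorant_of_leftFixedPoint_weighted` (`W = ℓ`, `Q ≡ 1`) on the left
fixed point `G′F = G′₀F + V(G′F)` (`conj_rightFix`). [cite: Balaban1985BackgroundPropagators, Thm 3.7 (3.87)–(3.90) pp.409–410, Thm 3.1 (3.42)₃ p.397, p.398 (remarks); Balaban1984PropagatorsII, Prop 2.2 (2.65)–(2.67) p.234] -/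
theorem hasMajorant_right_conj_Gp_of_cubes (d' : ℕ) {δ₀ α θ A : ℝ} {κ : Type} [Fintype κ]
    {G Δ : Module.End ℝ (SiteY i → 𝔸)} (T V : κ → Module.End ℝ (SiteY i → 𝔸))
    (Fb : Module.End ℝ (SiteY i × ι → ℝ)) (KF KV : κ → (geo9K i).Site → (geo9K i).Site → ℝ)
    {η : ℝ} (hη : η ≠ 0) (hA : 0 ≤ A) (hθ : 0 ≤ θ) (hαδ : 0 ≤ α * δ₀) (hαδ2 : 0 ≤ (1 - 2 * α) * δ₀)
    (htri : Triangle254 (toB6 (geo9K i) Rr Hp)) (hrefl : ∀ y : (geo9K i).Site, (geo9K i).dist y y = 0)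
    (hsym : ∀ y y' : (geo9K i).Site, (geo9K i).dist y y' = (geo9K i).dist y' y)
    (hdnn : ∀ y y' : (geo9K i).Site, 0 ≤ (geo9K i).dist y y') (hlenpos : ∀ y : (geo9K i).Site, 0 < (geo9K i).len y)
    (h261 : Ineq261 d' (toB6 (geo9K i) Rr Hp) δ₀ α) (h263 : Ineq263 d' (toB6 (geo9K i) Rr Hp) δ₀ α)
    (hsmall : θ * B6.c1 d' δ₀ α < 1)
    (hTF : ∀ k, HasMajorant (g := toB6 (geo9K i) Rr Hp) (fun p : SiteY i × ι => ιB (blkOf i.D.toDomains p.1))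
      (conj b ((η ^ 2) • T k) * Fb) (KF k))
    (hKF : ∀ a a', (∑ k, KF k a a') ≤ A * (geo9K i).len a * Real.exp (-(δ₀ * (geo9K i).dist a a')))
    (hV : ∀ k, HasMajorant (g := toB6 (geo9K i) Rr Hp) (fun p : SiteY i × ι => ιB (blkOf i.D.toDomains p.1)) (conj b (V k)) (KV k))
    (hKV : ∀ a a', (∑ k, KV k a a') ≤ θ * (geo9K i).len a * ((geo9K i).len a')⁻¹ * Real.exp (-(δ₀ * (geo9K i).dist a a')))
    (hinv : G * Δ = 1) (h388T : (∑ k, T k) * Δ = 1 - ∑ k, V k) :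
    HasMajorant (g := toB6 (geo9K i) Rr Hp) (fun p : SiteY i × ι => ιB (blkOf i.D.toDomains p.1)) (conj b ((η ^ 2) • G) * Fb)
      (fun a a' => A * B6.c1 d' δ₀ α * (1 - θ * B6.c1 d' δ₀ α)⁻¹ * (geo9K i).len a *
        Real.exp (-((1 - 2 * α) * δ₀ * (geo9K i).dist a a'))) := by
  -- G′₀F = Σ_□ (h_□G′_□h_□)F: the cube majorants add up to the OUTPUT-weighted A·ℓ(a)·1·e^{−δ₀d}
  have hT₀ : HasMajorantHom (g := toB6 (geo9K i) Rr Hp) (fun p : SiteY i × ι => ιB (blkOf i.D.toDomains p.1))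
      (fun p : SiteY i × ι => ιB (blkOf i.D.toDomains p.1)) (∑ k, conj b ((η ^ 2) • T k) * Fb)
      (fun a a' => A * (geo9K i).len a * 1 * Real.exp (-(δ₀ * (geo9K i).dist a a'))) :=
    (hasMajorantHom_iff (g := toB6 (geo9K i) Rr Hp) _ _ _).mpr
      (hasMajorant_mono (g := toB6 (geo9K i) Rr Hp) _
        (hasMajorant_finsetSum (G := toB6 (geo9K i) Rr Hp) _ Finset.univ (fun k => conj b ((η ^ 2) • T k) * Fb) KF fun k _ => hTF k)
        fun a a' => by rw [mul_one]; exact hKF a a')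
  -- V = Σ_□ V_□ has the scale-weighted majorant θ·ℓ(a)ℓ(a′)⁻¹·e^{−δ₀d}
  have hVs : HasMajorant (g := toB6 (geo9K i) Rr Hp) (fun p : SiteY i × ι => ιB (blkOf i.D.toDomains p.1)) (∑ k, conj b (V k))
      (fun a a' => θ * (geo9K i).len a * ((geo9K i).len a')⁻¹ * Real.exp (-(δ₀ * (geo9K i).dist a a'))) :=
    hasMajorant_mono (g := toB6 (geo9K i) Rr Hp) _
      (hasMajorant_finsetSum (G := toB6 (geo9K i) Rr Hp) _ Finset.univ (fun k => conj b (V k)) KV fun k _ => hV k) hKV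
  -- the left fixed point G′F = G′₀F + V(G′F)
  have hfix : conj b ((η ^ 2) • G) * Fb =
      (∑ k, conj b ((η ^ 2) • T k) * Fb) + (∑ k, conj b (V k)) ∘ₗ (conj b ((η ^ 2) • G) * Fb) :=
    conj_rightFix b Fb hη hinv h388T
  have htransfer : ∀ a a' : (geo9K i).Site, (1 : ℝ) ≤ 1 * 1 * Real.exp (α * δ₀ * (geo9K i).dist a a') := fun a a' => by
    rw [one_mul, one_mul]
    exact Real.one_le_exp (mul_nonneg hαδ (hdnn a a'))
  have h := hom_majorant_of_leftFixedPoint_weighted (g := toB6 (geo9K i) Rr Hp) (fun p : SiteY i × ι => ιB (blkOf i.D.toDomains p.1))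
    (fun p : SiteY i × ι => ιB (blkOf i.D.toDomains p.1)) d' δ₀ α θ A 1 (fun y => (geo9K i).len y) (fun _ => (1 : ℝ)) hA zero_le_one
    hlenpos (fun _ => zero_le_one) hθ hαδ hαδ2 htri hrefl hsym hdnn h261 h263 hsmall htransfer hT₀ hVs hfix
  refine hasMajorant_mono (g := toB6 (geo9K i) Rr Hp) _ ((hasMajorantHom_iff (g := toB6 (geo9K i) Rr Hp) _ _ _).mp h)
    fun a a' => le_of_eq ?_
  simp only [toB6_dist]
  ring

/-! ## §4 All four entries of (3.42) for `G′(U)` assembled and WRITTEN over the invariant class: the block `EBlock (kernelFamilySInv …)` at `U₁` -/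

omit [Fintype ι] [DecidableEq ι] [Fintype (geo9K i).Site] [DecidableEq (geo9K i).Site] in
/-- bookkeeping: a kernel `C·w·e^{−δ_a·d}` is dominated by `B·w·e^{−δ_b·d}` once `C ≤ B`, `0 ≤ B`, `0 ≤ w` and `δ_b·d ≤ δ_a·d` (p. 403 «of course with
different constants»; p. 410 «a decay rate arbitrarily close»). [cite: Balaban1985BackgroundPropagators, p.403 + p.410, bookkeeping] -/
theorem kernel_mono {C B w δa δb dd : ℝ} (hC : C ≤ B) (hB : 0 ≤ B) (hw : 0 ≤ w) (hδ : δb * dd ≤ δa * dd) :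
    C * w * Real.exp (-(δa * dd)) ≤ B * w * Real.exp (-(δb * dd)) := by
  have he : Real.exp (-(δa * dd)) ≤ Real.exp (-(δb * dd)) := Real.exp_le_exp.mpr (by linarith)
  calc C * w * Real.exp (-(δa * dd)) ≤ B * w * Real.exp (-(δa * dd)) :=
      mul_le_mul_of_nonneg_right (mul_le_mul_of_nonneg_right hC hw) (Real.exp_nonneg _)
    _ ≤ B * w * Real.exp (-(δb * dd)) := mul_le_mul_of_nonneg_left he (mul_nonneg hB hw)

variable {B : B9.Backgrounds} (cfg : B.Cfg → CfgY 𝔸 i) (O : SiteOpY 𝔸 i) (par : SiteParY 𝔸 i) {U₁ : B.Cfg}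

/-- ★★ **THEOREM 3.7 ⇒ ALL FOUR INEQUALITIES (3.42) FOR `G′(U)` AT A GENERAL CONFIGURATION, AS THE (3.42) BLOCK OF THE READING OVER THE
INVARIANT CLASS** (p. 410 «Theorem 3.7 implies that all the inequalities (3.42)–(3.47) hold for G′, thus we have completed the proof of Theorem
3.1»; here the four sup-norm entries (3.42)).  At `η = etaS i`, `G := η²·G′(U₁)` (the site letter `O` at `cfg U₁`, real scalars), the Laplacian letter
`Lap = Δ_{U₁}` (`hLap`) and the bond variables `Uc` of `cfg U₁` (`hUc`): FILE 1's first entry (inputs `hT`, `hcnt`), the `d + 1` forward entries and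
the Laplacian entry (§2; inputs `hTE μ`∕`hKE μ` with weight `ℓ` and constant `A₁`, `hTL`∕`hKL` with weight `1` and constant `A₃`), the `d + 1`
backward entries (§3; inputs `hTF μ`∕`hKF μ` with constant `A₂`, `hV`∕`hKV` with `θ_V`, `h388T`), the common inputs `h389`∕`hcnt'`, `hinv`, `h388`,
[4] Lemma 2.1 at exponent `α` above FILE 1 §5's threshold (`h261`, `h263`; the member's metric facts are theorems) and the two located smallness
conditions give, through the coordinate dictionary `B9CubeLettersInvWriteDict.eBlock_kernelFamilySInv_of_hasMajorant` (basis `b`, coordinate bound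
`M₂`, corner-free section `ιB` of `β`), the block `EBlock (kernelFamilySInv i B cfg O par) (M₂(Σ_j‖b_j‖)·Bc) ((1−2α)δ₀) U₁` with the SUM constant
`Bc = (N·B₀ + A₁ + A₃)·c₁(α)(1 − N′θc₁(α))⁻¹ + A₂·c₁(α)(1 − θ_Vc₁(α))⁻¹` written out term by term (p. 403 «of course with different constants»).
[cite: Balaban1985BackgroundPropagators, Thm 3.1 (3.42) p.397 via Thm 3.7 pp.409–410; Balaban1984PropagatorsII, Prop 2.2 (2.67) p.234] -/
theorem eBlock_kernelFamilySInv_Gp_of_cubes (hι : ∀ s, β i.hN i.D i.hk (ιB s) = s)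
    {M₂ : ℝ} (hM₂ : 0 ≤ M₂) (hrepr : ∀ (v : 𝔸) (j : ι), |b.repr v j| ≤ M₂ * ‖v‖)
    {Uc : Fin (d + 1) → SiteY i → 𝔸ˣ} (hUc : Uc = UboxY i (cfg U₁))
    (Lap : Module.End ℝ (SiteY i → 𝔸)) (hLap : ∀ Λ, Lap Λ = lapS i (cfg U₁) Λ)
    (d' : ℕ) {δ₀ α θ θV B₀ N N' A₁ A₂ A₃ : ℝ} {κ : Type} [Fintype κ]
    (S S' : κ → Finset (geo9K i).Site) {Δ : Module.End ℝ (SiteY i → 𝔸)} (T R V : κ → Module.End ℝ (SiteY i → 𝔸))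
    (KE KF : Fin (d + 1) → κ → (geo9K i).Site → (geo9K i).Site → ℝ) (KL KV : κ → (geo9K i).Site → (geo9K i).Site → ℝ)
    (hB₀ : 0 ≤ B₀) (hθ : 0 ≤ θ) (hθV : 0 ≤ θV) (hN : 0 ≤ N) (hN' : 0 ≤ N') (hA₁ : 0 ≤ A₁) (hA₂ : 0 ≤ A₂) (hA₃ : 0 ≤ A₃)
    (hαδ : 0 ≤ α * δ₀) (hαδ2 : 0 ≤ (1 - 2 * α) * δ₀)
    (h261 : Ineq261 d' (toB6 (geo9K i) Rr Hp) δ₀ α) (h263 : Ineq263 d' (toB6 (geo9K i) Rr Hp) δ₀ α)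
    (hsmall : N' * θ * B6.c1 d' δ₀ α < 1) (hsmallV : θV * B6.c1 d' δ₀ α < 1)
    (hT : ∀ k, HasMajorant (g := toB6 (geo9K i) Rr Hp) (fun p : SiteY i × ι => ιB (blkOf i.D.toDomains p.1))
      (conj b ((etaS i ^ 2) • T k))
      (fun a a' => if a ∈ S k then B₀ * (geo9K i).len a ^ 2 * Real.exp (-(δ₀ * (geo9K i).dist a a')) else 0))
    (hcnt : ∀ a : (geo9K i).Site, (∑ k, if a ∈ S k then (1 : ℝ) else 0) ≤ N)
    (h389 : ∀ k, HasMajorant (g := toB6 (geo9K i) Rr Hp) (fun p : SiteY i × ι => ιB (blkOf i.D.toDomains p.1)) (conj b (R k))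
      (fun a a' => if a ∈ S' k then θ * Real.exp (-(δ₀ * (geo9K i).dist a a')) else 0))
    (hcnt' : ∀ a : (geo9K i).Site, (∑ k, if a ∈ S' k then (1 : ℝ) else 0) ≤ N')
    (hTE : ∀ μ k, HasMajorant (g := toB6 (geo9K i) Rr Hp) (fun p : SiteY i × ι => ιB (blkOf i.D.toDomains p.1))
      (conj b (diffLetter (shiftY i) Uc (((etaS i : ℂ))⁻¹) (Sum.inl μ)) * conj b ((etaS i ^ 2) • T k)) (KE μ k))
    (hKE : ∀ μ a a', (∑ k, KE μ k a a') ≤ A₁ * (geo9K i).len a * Real.exp (-(δ₀ * (geo9K i).dist a a')))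
    (hTL : ∀ k, HasMajorant (g := toB6 (geo9K i) Rr Hp) (fun p : SiteY i × ι => ιB (blkOf i.D.toDomains p.1))
      (conj b ((etaS i ^ 2)⁻¹ • Lap) * conj b ((etaS i ^ 2) • T k)) (KL k))
    (hKL : ∀ a a', (∑ k, KL k a a') ≤ A₃ * 1 * Real.exp (-(δ₀ * (geo9K i).dist a a')))
    (hTF : ∀ μ k, HasMajorant (g := toB6 (geo9K i) Rr Hp) (fun p : SiteY i × ι => ιB (blkOf i.D.toDomains p.1))
      (conj b ((etaS i ^ 2) • T k) * conj b (diffLetter (shiftY i) Uc (((etaS i : ℂ))⁻¹) (Sum.inr μ))) (KF μ k))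
    (hKF : ∀ μ a a', (∑ k, KF μ k a a') ≤ A₂ * (geo9K i).len a * Real.exp (-(δ₀ * (geo9K i).dist a a')))
    (hV : ∀ k, HasMajorant (g := toB6 (geo9K i) Rr Hp) (fun p : SiteY i × ι => ιB (blkOf i.D.toDomains p.1)) (conj b (V k)) (KV k))
    (hKV : ∀ a a', (∑ k, KV k a a') ≤ θV * (geo9K i).len a * ((geo9K i).len a')⁻¹ * Real.exp (-(δ₀ * (geo9K i).dist a a')))
    (hinv : (O (cfg U₁)).restrictScalars ℝ * Δ = 1) (h388 : Δ * (∑ k, T k) = 1 - ∑ k, R k) (h388T : (∑ k, T k) * Δ = 1 - ∑ k, V k) :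
    EBlock (kernelFamilySInv i B cfg O par)
      (M₂ * (∑ j, ‖b j‖) *
        (N * B₀ * B6.c1 d' δ₀ α * (1 - N' * θ * B6.c1 d' δ₀ α)⁻¹ + A₁ * B6.c1 d' δ₀ α * (1 - N' * θ * B6.c1 d' δ₀ α)⁻¹ +
          A₂ * B6.c1 d' δ₀ α * (1 - θV * B6.c1 d' δ₀ α)⁻¹ + A₃ * B6.c1 d' δ₀ α * (1 - N' * θ * B6.c1 d' δ₀ α)⁻¹))
      ((1 - 2 * α) * δ₀) U₁ := by
  -- the member's metric facts (theorems of the k-level V1 family)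
  have htri : Triangle254 (toB6 (geo9K i) Rr Hp) :=
    (B9Thm34Ext.triangle254_toB6_iff (geo9K i) Rr Hp).2 (B9GeoLemma21KLevelV1.geo9K_dist_triangle i)
  have hrefl := B9GeoLemma21KLevelV1.geo9K_dist_self i
  have hsym := B9GeoLemma21KLevelV1.geo9K_dist_comm i
  have hdnn := B9GeoLemma21KLevelV1.geo9K_dist_nonneg' i
  have hlenpos := B9GeoLemma21KLevelV1.geo9K_len_pos i
  have hη0 : etaS i ≠ 0 := (etaS_pos i).ne'
  have hαδ1 : 0 ≤ (1 - α) * δ₀ := by linarith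
  -- abbreviations for the constants
  set c : ℝ := B6.c1 d' δ₀ α with hc
  have hc0 : 0 ≤ c := c1_nonneg d' δ₀ α
  have hinv0 : 0 ≤ (1 - N' * θ * c)⁻¹ := inv_nonneg.mpr (by linarith)
  have hinvV : 0 ≤ (1 - θV * c)⁻¹ := inv_nonneg.mpr (by linarith)
  have hC₀ : 0 ≤ N * B₀ * c * (1 - N' * θ * c)⁻¹ := mul_nonneg (mul_nonneg (mul_nonneg hN hB₀) hc0) hinv0
  have hC₁ : 0 ≤ A₁ * c * (1 - N' * θ * c)⁻¹ := mul_nonneg (mul_nonneg hA₁ hc0) hinv0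
  have hC₂ : 0 ≤ A₂ * c * (1 - θV * c)⁻¹ := mul_nonneg (mul_nonneg hA₂ hc0) hinvV
  have hC₃ : 0 ≤ A₃ * c * (1 - N' * θ * c)⁻¹ := mul_nonneg (mul_nonneg hA₃ hc0) hinv0
  set Bc : ℝ := N * B₀ * c * (1 - N' * θ * c)⁻¹ + A₁ * c * (1 - N' * θ * c)⁻¹ + A₂ * c * (1 - θV * c)⁻¹ +
    A₃ * c * (1 - N' * θ * c)⁻¹ with hBc
  have hBc0 : 0 ≤ Bc := by positivity
  have hle₀ : N * B₀ * c * (1 - N' * θ * c)⁻¹ ≤ Bc := by linarith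
  have hle₁ : A₁ * c * (1 - N' * θ * c)⁻¹ ≤ Bc := by linarith
  have hle₂ : A₂ * c * (1 - θV * c)⁻¹ ≤ Bc := by linarith
  have hle₃ : A₃ * c * (1 - N' * θ * c)⁻¹ ≤ Bc := by linarith
  have hrate : ∀ a a' : (geo9K i).Site, (1 - 2 * α) * δ₀ * (geo9K i).dist a a' ≤ (1 - α) * δ₀ * (geo9K i).dist a a' := fun a a' => by
    have h := mul_nonneg hαδ (hdnn a a')
    nlinarith
  -- the letters at `cfg U₁`
  set G : Module.End ℝ (SiteY i → 𝔸) := (etaS i ^ 2) • (O (cfg U₁)).restrictScalars ℝ with hG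
  have hGap : ∀ Λ, G Λ = (etaS i ^ 2) • O (cfg U₁) Λ := fun Λ => rfl
  have hLapap : ∀ Λ, ((etaS i ^ 2)⁻¹ • Lap) Λ = (etaS i ^ 2)⁻¹ • lapS i (cfg U₁) Λ := fun Λ => by
    rw [LinearMap.smul_apply, hLap]
  -- entry 1 (FILE 1), entries 2 and 4 (§2), entry 3 (§3)
  have h0 := hasMajorant_conj_Gp_of_cubes i b ιB d' S S' T R hη0 hB₀ hθ hN hN' hαδ1 htri hrefl hdnn h261 h263 hsmall hT hcnt h389 hcnt'
    hinv h388
  have h1 : ∀ μ : Fin (d + 1), HasMajorant (g := toB6 (geo9K i) Rr Hp) (fun p : SiteY i × ι => ιB (blkOf i.D.toDomains p.1))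
      (conj b (diffLetter (shiftY i) Uc (((etaS i : ℂ))⁻¹) (Sum.inl μ)) * conj b G)
      (fun a a' => A₁ * c * (1 - N' * θ * c)⁻¹ * (geo9K i).len a * Real.exp (-((1 - α) * δ₀ * (geo9K i).dist a a'))) := fun μ =>
    hasMajorant_left_conj_Gp_of_cubes i b ιB d' S' T R _ (fun a => (geo9K i).len a) (KE μ) hη0 hA₁ (fun a => (hlenpos a).le) hθ hN' hαδ1
      htri hrefl hdnn h261 h263 hsmall (hTE μ) (hKE μ) h389 hcnt' hinv h388
  have h3 : HasMajorant (g := toB6 (geo9K i) Rr Hp) (fun p : SiteY i × ι => ιB (blkOf i.D.toDomains p.1))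
      (conj b ((etaS i ^ 2)⁻¹ • Lap) * conj b G)
      (fun a a' => A₃ * c * (1 - N' * θ * c)⁻¹ * 1 * Real.exp (-((1 - α) * δ₀ * (geo9K i).dist a a'))) :=
    hasMajorant_left_conj_Gp_of_cubes i b ιB d' S' T R _ (fun _ => (1 : ℝ)) KL hη0 hA₃ (fun _ => zero_le_one) hθ hN' hαδ1
      htri hrefl hdnn h261 h263 hsmall hTL hKL h389 hcnt' hinv h388
  have h2 : ∀ μ : Fin (d + 1), HasMajorant (g := toB6 (geo9K i) Rr Hp) (fun p : SiteY i × ι => ιB (blkOf i.D.toDomains p.1))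
      (conj b G * conj b (diffLetter (shiftY i) Uc (((etaS i : ℂ))⁻¹) (Sum.inr μ)))
      (fun a a' => A₂ * c * (1 - θV * c)⁻¹ * (geo9K i).len a * Real.exp (-((1 - 2 * α) * δ₀ * (geo9K i).dist a a'))) := fun μ =>
    hasMajorant_right_conj_Gp_of_cubes i b ιB d' T V _ (KF μ) KV hη0 hA₂ hθV hαδ hαδ2 htri hrefl hsym hdnn hlenpos h261 h263 hsmallV
      (hTF μ) (hKF μ) hV hKV hinv h388T
  -- common constant `Bc`, common rate `(1 − 2α)δ₀`, and the dictionary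
  refine eBlock_kernelFamilySInv_of_hasMajorant i b cfg O par (Rr := Rr) (Hp := Hp) ιB hι hM₂ hrepr (η := etaS i) rfl hUc G
    ((etaS i ^ 2)⁻¹ • Lap) hGap hLapap hBc0 ?_ ?_ ?_ ?_
  · exact hasMajorant_mono (g := toB6 (geo9K i) Rr Hp) _ h0 fun a a' =>
      kernel_mono hle₀ hBc0 (sq_nonneg _) (hrate a a')
  · exact fun μ => hasMajorant_mono (g := toB6 (geo9K i) Rr Hp) _ (h1 μ) fun a a' =>
      kernel_mono hle₁ hBc0 (hlenpos a).le (hrate a a')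
  · exact fun μ => hasMajorant_mono (g := toB6 (geo9K i) Rr Hp) _ (h2 μ) fun a a' =>
      kernel_mono hle₂ hBc0 (hlenpos a).le le_rfl
  · exact hasMajorant_mono (g := toB6 (geo9K i) Rr Hp) _ h3 fun a a' =>
      kernel_mono hle₃ hBc0 zero_le_one (hrate a a')

end Cubes

end Literature.MathematicalPhysics.QuantumFieldTheory.Balaban1983to89.B9Thm37GpTorusRegularEntries

end
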